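import Summits.BirchSwinnertonDyer.BirchSwinnertonDyer.Theorems.SylvesterTwoHeegnerIndexLocalTypes
import Summits.BirchSwinnertonDyer.Rank1Residual.X11b.KolyvaginReductionDatum
import Literature.NumberTheory.EllipticCurves.ModularityVersionAp
import Literature.NumberTheory.DiophantineGeometry.ConductorExponentZeroProofs
import Literature.NumberTheory.DiophantineGeometry.TateAlgorithmProofs
import HarnessLib

/-!
# K7t crux `UpperOffV0HSYPlus` (item 19804), line `offv0-kolyvagin2`: `3 ∣ N(E_p)` on 𝒞_HSY

Helper file of route `SylvesterTwoHeegnerIndex` (cell bsd-cm, rung K7t).  Discharges the side condition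
`h3N : 3 ∣ N` (with `hN : N = W.conductorNorm ℤ`) of k7t-c2 g6's `2`-adic assembly
(`hpoints_at_two_of_perLevelChoice_sylvester(_of_congruence)`, `sha_two_primary_exponent_sylvester_…`)
on the class 𝒞_HSY: for `p ≡ 4, 7 (mod 9)` prime and every `ℚ`-model `W` of `E_p`, the Kodaira type at
`3` is `IV*` / `III*` (k7t-c2 g2's `SylvesterTwoLocalTypes.kodairaSymbolAt_of_model`, Rizzo Table II),
so `W` has bad reduction at `3` (Tate's algorithm returns `I₀` exactly on good reduction, tree
`isGood_kodairaSymbolAt_iff_holds`) and `3 ∣ N_W` (`f_v = 0 ↔` good reduction, tree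
`dvd_conductorNorm_iff_not_hasGoodReductionAt` / `conductorExponent_eq_zero_iff_holds`).
THEOREM ONLY; no definition, no named fact, no `sorry`; BSD not claimed.
References: [Rizzo2003] Table II; [Silverman1994] IV.9.4, IV.10.2(a); [DiamondShurman2005] §8.3.
-/

set_option autoImplicit false
set_option linter.dupNamespace false

noncomputable section

open scoped Classical
open WeierstrassCurve NumberField IsDedekindDomain
open Literature.NumberTheory.EllipticCurves Rat.HeightOneSpectrum
open Summit.BirchSwinnertonDyer.Rank1Residual.X11b.KolyvaginH44

namespace Summit.BirchSwinnertonDyer.BirchSwinnertonDyer.Theorems.SylvesterTwoUpper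

/-- **`3 ∣ N(E_p)` for `p ≡ 4, 7 (mod 9)`**: every `ℚ`-model `W` of `E_p` has Kodaira type `IV*` or
`III*` at `3`, hence bad reduction at `3`, hence `3` divides its conductor.
[cite: Rizzo2003, Table II (p. 4)] [cite: Silverman1994, IV.10.2(a)] [cite: DiamondShurman2005, §8.3] -/
theorem three_dvd_conductorNorm_of_model {p : ℕ} (hp : p.Prime) (h9 : p % 9 = 4 ∨ p % 9 = 7)
    (W : WeierstrassCurve ℚ) [W.IsElliptic]
    (hW : ∃ C : VariableChange ℚ, C • W = HuShuYin2019.cubeSumCurve (p : ℚ)) :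
    3 ∣ W.conductorNorm ℤ := by
  haveI : Fact (Nat.Prime 3) := ⟨Nat.prime_three⟩
  obtain ⟨v, hv, -⟩ := exists_ratPlace 3
  have hbad : ¬ W.HasGoodReductionAt v := by
    intro hgood
    have hk : W.kodairaSymbolAt v = if p % 9 = 4 then .IVstar else .IIIstar :=
      (SylvesterTwoLocalTypes.kodairaSymbolAt_of_model hp h9 W hW v).2 hv
    have hg := (W.isGood_kodairaSymbolAt_iff_holds v).mpr hgood
    rw [Literature.NumberTheory.DiophantineGeometry.KodairaSymbol.IsGood, hk] at hg
    split_ifs at hg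
  have h := (W.dvd_conductorNorm_iff_not_hasGoodReductionAt (v := v)
    (fun u ↦ WeierstrassCurve.conductorExponent_eq_zero_iff_holds u W)).mpr hbad
  rwa [hv] at h

end Summit.BirchSwinnertonDyer.BirchSwinnertonDyer.Theorems.SylvesterTwoUpper

end
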